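import Summits.ResolutionOfSingularities.ResolutionOfSingularities.Theorems.HilbertSamuelEliminationSigmaMaxModificationsCorridor3WLadderIsoTailsFreeRationalArcLimit
import HarnessLib

/-!
# [OURS · L1 W4.2] REGISTERED STUB `stub_isoK1` OF SKELETON `w_ladder_rows` v8.5 (cddb67d3211b8282; v8.4 e256a1a7c29399f9) on
# stmt-ResolutionOfSingularities-19249 — CLOSED BY NAME AND SIGNATURE (crux chain w42, stub worker res-L1-w42-stub-2 gen 5)

OURS (cell res-hironaka, slot W4.2); NOT a statement of H. Hironaka's manuscript [Hironaka2017] nor of [CossartJannsenSaito2020] /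
[CossartPiltant2009]; AI proving, weaker than expert review. The registered signature (res-L1-w42-lead-1 g5 REGISTERED 16:00:46Z / 16:06:06Z,
res-L1-w42-plan-1 RULING v3.14-40 (JQ) «line of record v8.5») is K1 of the isolated kernel T3 — «free-rational tails are impossible» — at level `3`
for a prime `p`; the proof is the unconditional, every-embedding-dimension theorem `IsoTailsHS.isoFreeRationalTailsImpossible_holds`
(`…Corridor3WLadderIsoTailsFreeRationalArcLimit`: ROUTE G v2 «ARC LIMIT» — res-L1-w42-lead-1's G2c limit inequality, res-type-071's frame link,
res-D-pv-010's / res-type-038's frames, res-type-001's H∞-FINAL-G, assembled by this seat). `--supports stmt-ResolutionOfSingularities-19249`.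

## References
* V. Cossart, O. Piltant, J. Algebra 321 (2009), ch. 3 I.9 (formal arcs). [CossartPiltant2009]
* M. Herrmann, S. Ikeda, U. Orbanz, *Equimultiplicity and Blowing up* (1988), Thm. (22.24), Prop. (30.1). [HerrmannIkedaOrbanz1988]
* V. Cossart, U. Jannsen, S. Saito, LNM 2270 (2020), Def. 6.34, Def. 6.38. [CossartJannsenSaito2020]
-/

noncomputable section

set_option linter.dupNamespace false -- mandated namespace of this single-conjunct summit

open Summit.ResolutionOfSingularities.ResolutionOfSingularities.Theorems.SigmaMaxModificationsCorridor3
open Summit.ResolutionOfSingularities.ResolutionOfSingularities.Cruxes.SigmaMaxModifications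

namespace Summit.ResolutionOfSingularities.ResolutionOfSingularities.Cruxes.SigmaMaxModificationsCorridor3.WLadder

/-- **REGISTERED STUB `stub_isoK1` (skeleton `w_ladder_rows` v8.5, cddb67d3211b8282) — K1: over a maximal origin of characteristic `p` at
level `3`, no isolated E3 point tower is eventually free-rational.** [OURS · L1 W4.2] The isolated kernel's arc half, in EVERY embedding
dimension; NOT a statement of the manuscript. [cite: CossartPiltant2009, ch. 3 I.9] [cite: HerrmannIkedaOrbanz1988, Thm. (22.24)] -/
theorem stub_isoK1 : ∀ p : ℕ, p.Prime → IdeasL1C5.IsoFreeRationalTailsImpossible.{0} p 3 :=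
  fun p _ => IsoTailsHS.isoFreeRationalTailsImpossible_holds p

end Summit.ResolutionOfSingularities.ResolutionOfSingularities.Cruxes.SigmaMaxModificationsCorridor3.WLadder

end
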